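import Literature.MathematicalPhysics.QuantumFieldTheory.Balaban1983to89.Node00.OpsYIds3152Reduction
import Literature.MathematicalPhysics.QuantumFieldTheory.Balaban1983to89.Node00.OpsYSectDQ
import Literature.MathematicalPhysics.QuantumFieldTheory.Balaban1983to89.Node00.OpsYQLetter
import Literature.MathematicalPhysics.QuantumFieldTheory.Balaban1983to89.B9Eq325RIdentitiesKnitPairY

/-!
# (3.152) and (3.124) OVER A GENERIC AVERAGING PAIR `(𝔮, 𝔮⋆)` AND SITE TRANSPORT `parS` REDUCE to one constraint — and at print's KNIT PAIR on
# (3.35) to NONE — Balaban, Commun. Math. Phys. **99** (1985) 389–434, pp. 418–420, 425–426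

[cite: Balaban1985BackgroundPropagators, (3.115) p.418, (3.119) p.419, (3.122) p.420, (3.124) p.420, (3.128) p.421, (3.134) p.422, (3.138) p.423,
(3.147)–(3.152) pp.425–426, (3.19)–(3.25) pp.393–395, (3.8) p.392, (3.13) p.393, (3.35) p.396] [cite: Balaban1985Averaging, Prop. 2 p.26]

Print (p. 426): *«RD\*G₁ = RG′D\*, and G₁DR = DG′R (3.152) … QG₁DR = QDG′R = D₁Q′G′R = 0»*.  `Node00.OpsYIds3152Reduction` proved the ALGEBRA of
that paragraph at def-Y's straight-contour pair `(QY parB, QsY parB)` keyed at the symmetrised site transport `parSymY`, reducing the five displayed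
identities of the N06 knit to ONE constraint `hZ : Q D Γ R = 0`, and recorded honestly (located gap O5) that `hZ` fails for THAT pair at a curved
background.  The v10 record of director-ym №375 «R2-A» (`Node00.OpsYSectDQ`: `deltaOneQY 𝔮 𝔮⋆ parS Gp Δ2` = print's `G₁⁻¹` (3.128) after (3.134),
`G1QY = Ring.inverse deltaOneQY`) makes the averaging pair `(𝔮, 𝔮⋆)` AND the site transport `parS` parameters, and dag-n06-l's (L8) supplier
(`B9Eq3124HZKnitPairReg335Y`) proves `hZ` for PRINT's pair — the knit letter `QknitY` (3.115) with its trace adjoint — keyed at print's knit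
transport `parKnitY` ([Balaban1985Averaging] Prop. 2), on print's local class (3.35).  This file is the GENERIC twin of `Node00.OpsYIds3152Reduction`
in which the two meet:

* §1–§2 (pure algebra: any coefficient algebra `𝔸`, any `parS`, `Γ := Gp`, `R := RY parS Gp`): from the two (3.24)–(3.25) identities DISPLAYED
  as hypotheses `hRL : R Γ D* D R = R`, `hRR : R D* D Γ R = R` — the Gaussian computations `(RΓD*) ∘ G₁⁻¹ = RD* + (RΓD*)(𝔮⋆a𝔮)`,
  `G₁⁻¹ ∘ (DΓR) = DR + (𝔮⋆a𝔮)(DΓR)`, and, wherever `G₁⁻¹(U)` is a unit (`hM1` — (3.138), NOT claimed), the five identities (3.152) `RD*G₁ = RΓD*`,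
  `G₁DR = DΓR`, (3.124) `𝔮G₁DR = 0`, `RD*G₁𝔮⋆ = 0`, `RD*G₁DR = R` from `hZ : 𝔮 D Γ R = 0` and its transpose `hZt : R Γ D* 𝔮⋆ = 0`
  (★★★ `ids3152Q_of_hZ_hZt`);
* §3 (`𝔸 = M_N(ℂ)`): `hZ → hZt` whenever `𝔮⋆(U)` is the trace adjoint of `𝔮(U)` ((3.13)), `D*_U` that of `D_U` ((3.8)) and `Γ(U)`, `R(U)` are
  symmetric — displayed hypotheses (★★ `RY_Gp_divY_qs_of_hZ`, ★★★ `ids3152Q_of_hZ`);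
* §4 THE TWO KEYINGS, every hypothesis of §1–§3 discharged BY NAME: at `parS := parSymY`, `Γ := G′_phys` (def-Y's `Node00.OpsYDeltaPrimeAFactor` §2:
  `G`-valued background, `G ≤ U(N)`, `c_f η = 1`) ★★★ `ids3152Q_of_hZ_parSymY`; at `parS := parKnitY` (dag-n06-l's `B9Eq325RIdentitiesKnitPairY`
  §2–§3: knit legs `G`-valued, resp. on (3.35) at `G := U(N)`) ★★★ `ids3152Q_of_hZ_parKnitY`, `ids3152Q_of_hZ_parKnitY_of_reg335P` — each with the
  ONE binder `hZ` (plus the pair's adjointness (L3));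
* §5 ★★★ AT PRINT'S KNIT PAIR `(QknitY, adjTrY ∘ QknitY)` ON (3.35) THE BINDER IS GONE: `hZ` is dag-n06-l's theorem
  `QknitY_gradY_GpPhysY_RY_parKnitY_of_reg335P` and `𝔮⋆ = 𝔮†` by construction (`isAdjTr_adjTrY`), so (3.152) and (3.124) hold at every background
  of the member's class given ONLY the invertibility `hM1` of `G₁⁻¹(U)` (★★★ `ids3152Q_knitPair_of_reg335P`; record-level ★★★
  `ids3152Q_qKnitOfRecord_of_regQY` for def-Y's knit family of record `(qKnitOfRecord, qsKnitOfRecord)` on the regime of record `regQY`); and the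
  N06 certificate's row shape — the laws (L8) `IsNullOnQ` + (L3) `IsAdjOnQ` of a generic pair as binders — ★★ `ids3152Q_of_isNullOnQ_parKnitY_regQY`,
  `ids3152Q_of_isNullOnQ_parSymY_regQY`.

At the straight-contour pair the generic statements ARE the old ones on the nose (`Node00.OpsYSectDQ`: `deltaOneQY_QY`, `G1QY_QY` are `rfl`), so
nothing of `Node00.OpsYIds3152Reduction` is restated.  HONEST STATUS: nothing of (3.138) (`hM1`) or of [B9]'s estimates is asserted; `hZ` for the
straight pair at `parSymY` remains the located gap O5 (not claimed here); at the knit pair on (3.35) it is a theorem of the tree.  0 `def`, 0 `sorry`.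
-/

namespace Literature.MathematicalPhysics.QuantumFieldTheory.Balaban1983to89.Node00

open B6KLevelCensusIndexV1 (KIdx kGeo)
open B9Eq3132SectDLetters (gaugePiY gaugePiTY)
open B9Thm311ReadingCoords (IsSymmTr IsAdjTr)
open B9Thm311AdjointPairs (isAdjTr_gradY_divY GpY_isSymmTr)
open B9B8AveragingJunction (parKnitY)
open B9B8KnitLetterGpDecay (symm0_parKnitY)
open B9B8KnitLetterProjectionC (RY_parKnitY_isSymmTr)
open B9Eq325RIdentitiesKnitPairY (RY_GpPhysY_divY_gradY_RY_parKnitY RY_divY_gradY_GpPhysY_RY_parKnitY)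
open B9Eq3115KnitLetterY (QknitY)
open B9Eq3124HZKnitPairReg335Y (QknitY_gradY_GpPhysY_RY_parKnitY_of_reg335P parKnitY_mem_unitary_of_reg335P)
open B7Prop2Explicit (C0 c2' unitaryUnits)
open B9C2FormBoxRegimeY (Kpl)
open B9BackgroundsKLevelV1P (bg9KP mem_of_reg335P)
open OpsYQLetter (QLetterY QsLetterY adjTrY isAdjTr_adjTrY IsNullOnQ IsAdjOnQ regQY mem_of_regQY qKnitOfRecord qsKnitOfRecord)
open scoped Matrix

noncomputable section

variable {d ℓ : ℕ} {hd : 1 ≤ d + 1} {hL : Odd (ℓ + 1) ∧ 1 < ℓ + 1} {b₀ b₁ : ℝ}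

/-! ## §1 The two Gaussian computations of (3.151) over `(𝔮, 𝔮⋆, parS, Γ)`, from the displayed (3.24)–(3.25) identities `hRL`, `hRR` -/

section Gaussian

variable {𝔸 : Type} [NormedRing 𝔸] [NormedAlgebra ℂ 𝔸] [CompleteSpace 𝔸]
variable (i : KIdx d ℓ hd hL b₀ b₁)
variable (𝔮 : CfgY 𝔸 i → ((FBondY i → 𝔸) →ₗ[ℂ] (IBondY i → 𝔸))) (𝔮s : CfgY 𝔸 i → ((IBondY i → 𝔸) →ₗ[ℂ] (FBondY i → 𝔸)))
variable {parS : SiteParY 𝔸 i} {Gp : SiteOpY 𝔸 i} (Δ2 : BondOpY 𝔸 i) {U : CfgY 𝔸 i}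

/-- `R Γ D* ∘ (1 − D R Γ D*) = 0`: `R Γ D*` annihilates the range of the adjoint gauge projection `π† = gaugePiTY` (3.119), from `hRL : R Γ D* D R = R`
((3.24)–(3.25): `Node00.OpsYDeltaPrimeAFactor` at `parSymY`, `B9Eq325RIdentitiesKnitPairY` at `parKnitY`).
[cite: Balaban1985BackgroundPropagators, (3.119) p.419, (3.147) p.425, (3.24)–(3.25) p.394] -/
theorem RY_Gp_divY_gaugePiTY_of_hRL (hRL : RY i parS Gp U ∘ₗ Gp U ∘ₗ divY i U ∘ₗ gradY i U ∘ₗ RY i parS Gp U = RY i parS Gp U) :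
    RY i parS Gp U ∘ₗ Gp U ∘ₗ divY i U ∘ₗ gaugePiTY i parS Gp U = 0 := by
  have hT : gaugePiTY i parS Gp U = LinearMap.id - gradY i U ∘ₗ RY i parS Gp U ∘ₗ Gp U ∘ₗ divY i U := rfl
  rw [hT, LinearMap.comp_sub, LinearMap.comp_sub, LinearMap.comp_sub, LinearMap.comp_id,
    ← LinearMap.comp_assoc (Gp U ∘ₗ divY i U), ← LinearMap.comp_assoc (Gp U ∘ₗ divY i U),
    ← LinearMap.comp_assoc (Gp U ∘ₗ divY i U), ← LinearMap.comp_assoc (Gp U ∘ₗ divY i U), hRL, sub_self]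

/-- `(1 − D Γ R D*) ∘ D Γ R = 0`: the gauge projection `π = gaugePiY` (3.119) kills the gauge modes `D Γ R f`, from `hRR : R D* D Γ R = R`.
[cite: Balaban1985BackgroundPropagators, (3.119) p.419, (3.147) p.425, (3.24)–(3.25) p.394] -/
theorem gaugePiY_gradY_Gp_RY_of_hRR (hRR : RY i parS Gp U ∘ₗ divY i U ∘ₗ gradY i U ∘ₗ Gp U ∘ₗ RY i parS Gp U = RY i parS Gp U) :
    gaugePiY i parS Gp U ∘ₗ gradY i U ∘ₗ Gp U ∘ₗ RY i parS Gp U = 0 := by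
  have h : (gradY i U ∘ₗ Gp U ∘ₗ RY i parS Gp U ∘ₗ divY i U) ∘ₗ (gradY i U ∘ₗ Gp U ∘ₗ RY i parS Gp U)
      = gradY i U ∘ₗ Gp U ∘ₗ (RY i parS Gp U ∘ₗ divY i U ∘ₗ gradY i U ∘ₗ Gp U ∘ₗ RY i parS Gp U) := by
    simp only [LinearMap.comp_assoc]
  have hP : gaugePiY i parS Gp U = LinearMap.id - gradY i U ∘ₗ Gp U ∘ₗ RY i parS Gp U ∘ₗ divY i U := rfl
  rw [hP, LinearMap.sub_comp, LinearMap.id_comp, h, hRR, sub_self]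

/-- ★★ **`(R Γ D*) ∘ G₁⁻¹ = R D* + (R Γ D*) ∘ (𝔮⋆ a 𝔮)`** for `G₁⁻¹ = Δ_π − Δ⁽²⁾_π + DRD* + 𝔮⋆a𝔮` (`deltaOneQY`, (3.128) after (3.134)): the `Δ_π`,
`Δ⁽²⁾_π` terms die on `π†` (`RY_Gp_divY_gaugePiTY_of_hRL`) and `RΓD* ∘ DRD* = (RΓD*DR) D* = R D*` (`hRL`).
[cite: Balaban1985BackgroundPropagators, (3.151) p.425, (3.122) p.420, (3.134) p.422] -/
theorem RY_Gp_divY_deltaOneQY_of_hRL (hRL : RY i parS Gp U ∘ₗ Gp U ∘ₗ divY i U ∘ₗ gradY i U ∘ₗ RY i parS Gp U = RY i parS Gp U) :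
    (RY i parS Gp U ∘ₗ Gp U ∘ₗ divY i U) ∘ₗ deltaOneQY i 𝔮 𝔮s parS Gp Δ2 U
      = RY i parS Gp U ∘ₗ divY i U + (RY i parS Gp U ∘ₗ Gp U ∘ₗ divY i U) ∘ₗ (𝔮s U ∘ₗ aY i ∘ₗ 𝔮 U) := by
  have h0 : (RY i parS Gp U ∘ₗ Gp U ∘ₗ divY i U) ∘ₗ gaugePiTY i parS Gp U = 0 := by
    rw [LinearMap.comp_assoc, LinearMap.comp_assoc]
    exact RY_Gp_divY_gaugePiTY_of_hRL i hRL
  have hT1 : (RY i parS Gp U ∘ₗ Gp U ∘ₗ divY i U) ∘ₗ (gaugePiTY i parS Gp U ∘ₗ hessY i U ∘ₗ gaugePiY i parS Gp U) = 0 := by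
    rw [← LinearMap.comp_assoc, h0, LinearMap.zero_comp]
  have hT4 : (RY i parS Gp U ∘ₗ Gp U ∘ₗ divY i U) ∘ₗ (gaugePiTY i parS Gp U ∘ₗ Δ2 U ∘ₗ gaugePiY i parS Gp U) = 0 := by
    rw [← LinearMap.comp_assoc, h0, LinearMap.zero_comp]
  have hT2 : (RY i parS Gp U ∘ₗ Gp U ∘ₗ divY i U) ∘ₗ (gradY i U ∘ₗ RY i parS Gp U ∘ₗ divY i U) = RY i parS Gp U ∘ₗ divY i U := by
    have h6 : (RY i parS Gp U ∘ₗ Gp U ∘ₗ divY i U ∘ₗ gradY i U ∘ₗ RY i parS Gp U) ∘ₗ divY i U = RY i parS Gp U ∘ₗ divY i U := by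
      rw [hRL]
    rw [LinearMap.comp_assoc, LinearMap.comp_assoc, LinearMap.comp_assoc, LinearMap.comp_assoc] at h6
    rw [LinearMap.comp_assoc, LinearMap.comp_assoc]
    exact h6
  have hM : deltaOneQY i 𝔮 𝔮s parS Gp Δ2 U
      = (gaugePiTY i parS Gp U ∘ₗ hessY i U ∘ₗ gaugePiY i parS Gp U + gradY i U ∘ₗ RY i parS Gp U ∘ₗ divY i U + 𝔮s U ∘ₗ aY i ∘ₗ 𝔮 U)
        - gaugePiTY i parS Gp U ∘ₗ Δ2 U ∘ₗ gaugePiY i parS Gp U := rfl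
  rw [hM, LinearMap.comp_sub, LinearMap.comp_add, LinearMap.comp_add, hT1, hT4, hT2, zero_add, sub_zero]

/-- ★★ **`G₁⁻¹ ∘ (D Γ R) = D R + (𝔮⋆ a 𝔮) ∘ (D Γ R)`**: the `Δ_π`, `Δ⁽²⁾_π` terms die on `π` (`gaugePiY_gradY_Gp_RY_of_hRR`) and `DRD* ∘ DΓR = D (RD*DΓR) = D R`
(`hRR`). [cite: Balaban1985BackgroundPropagators, (3.151) p.425, (3.122) p.420, (3.134) p.422] -/
theorem deltaOneQY_gradY_Gp_RY_of_hRR (hRR : RY i parS Gp U ∘ₗ divY i U ∘ₗ gradY i U ∘ₗ Gp U ∘ₗ RY i parS Gp U = RY i parS Gp U) :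
    deltaOneQY i 𝔮 𝔮s parS Gp Δ2 U ∘ₗ gradY i U ∘ₗ Gp U ∘ₗ RY i parS Gp U
      = gradY i U ∘ₗ RY i parS Gp U + (𝔮s U ∘ₗ aY i ∘ₗ 𝔮 U) ∘ₗ gradY i U ∘ₗ Gp U ∘ₗ RY i parS Gp U := by
  have hπ := gaugePiY_gradY_Gp_RY_of_hRR i hRR
  have hU1 : (gaugePiTY i parS Gp U ∘ₗ hessY i U ∘ₗ gaugePiY i parS Gp U) ∘ₗ gradY i U ∘ₗ Gp U ∘ₗ RY i parS Gp U = 0 := by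
    rw [LinearMap.comp_assoc, LinearMap.comp_assoc, hπ, LinearMap.comp_zero, LinearMap.comp_zero]
  have hU4 : (gaugePiTY i parS Gp U ∘ₗ Δ2 U ∘ₗ gaugePiY i parS Gp U) ∘ₗ gradY i U ∘ₗ Gp U ∘ₗ RY i parS Gp U = 0 := by
    rw [LinearMap.comp_assoc, LinearMap.comp_assoc, hπ, LinearMap.comp_zero, LinearMap.comp_zero]
  have hU2 : (gradY i U ∘ₗ RY i parS Gp U ∘ₗ divY i U) ∘ₗ gradY i U ∘ₗ Gp U ∘ₗ RY i parS Gp U = gradY i U ∘ₗ RY i parS Gp U := by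
    rw [LinearMap.comp_assoc, LinearMap.comp_assoc, hRR]
  have hM : deltaOneQY i 𝔮 𝔮s parS Gp Δ2 U
      = (gaugePiTY i parS Gp U ∘ₗ hessY i U ∘ₗ gaugePiY i parS Gp U + gradY i U ∘ₗ RY i parS Gp U ∘ₗ divY i U + 𝔮s U ∘ₗ aY i ∘ₗ 𝔮 U)
        - gaugePiTY i parS Gp U ∘ₗ Δ2 U ∘ₗ gaugePiY i parS Gp U := rfl
  rw [hM, LinearMap.sub_comp, LinearMap.add_comp, LinearMap.add_comp, hU1, hU4, hU2, zero_add, sub_zero]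

/-! ## §2 Wherever `G₁⁻¹(U)` is a unit: (3.152) and (3.124) from `hZ : 𝔮 D Γ R = 0` and its transpose `hZt : R Γ D* 𝔮⋆ = 0` -/

/-- `R D* G₁ = R Γ D* − (R Γ D* 𝔮⋆ a 𝔮) G₁` wherever `G₁⁻¹ := deltaOneQY` is a unit (then `G1QY = (deltaOneQY)⁻¹`).
[cite: Balaban1985BackgroundPropagators, (3.151)–(3.152) pp.425–426, (3.138) p.423] -/
theorem RY_divY_G1QY (hRL : RY i parS Gp U ∘ₗ Gp U ∘ₗ divY i U ∘ₗ gradY i U ∘ₗ RY i parS Gp U = RY i parS Gp U)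
    (hM1 : IsUnit (deltaOneQY i 𝔮 𝔮s parS Gp Δ2 U)) :
    (RY i parS Gp U ∘ₗ divY i U) ∘ₗ G1QY i 𝔮 𝔮s parS Gp Δ2 U
      = RY i parS Gp U ∘ₗ Gp U ∘ₗ divY i U
        - ((RY i parS Gp U ∘ₗ Gp U ∘ₗ divY i U) ∘ₗ (𝔮s U ∘ₗ aY i ∘ₗ 𝔮 U)) ∘ₗ G1QY i 𝔮 𝔮s parS Gp Δ2 U := by
  have hinv : deltaOneQY i 𝔮 𝔮s parS Gp Δ2 U ∘ₗ G1QY i 𝔮 𝔮s parS Gp Δ2 U = LinearMap.id := Ring.mul_inverse_cancel _ hM1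
  have h : ((RY i parS Gp U ∘ₗ Gp U ∘ₗ divY i U) ∘ₗ deltaOneQY i 𝔮 𝔮s parS Gp Δ2 U) ∘ₗ G1QY i 𝔮 𝔮s parS Gp Δ2 U
      = (RY i parS Gp U ∘ₗ divY i U + (RY i parS Gp U ∘ₗ Gp U ∘ₗ divY i U) ∘ₗ (𝔮s U ∘ₗ aY i ∘ₗ 𝔮 U)) ∘ₗ G1QY i 𝔮 𝔮s parS Gp Δ2 U := by
    rw [RY_Gp_divY_deltaOneQY_of_hRL i 𝔮 𝔮s Δ2 hRL]
  rw [LinearMap.comp_assoc, hinv, LinearMap.comp_id, LinearMap.add_comp] at h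
  exact eq_sub_of_add_eq h.symm

/-- `G₁ D R = D Γ R − G₁ (𝔮⋆ a 𝔮 D Γ R)` wherever `G₁⁻¹ := deltaOneQY` is a unit. [cite: Balaban1985BackgroundPropagators, (3.151)–(3.152) pp.425–426, (3.138) p.423] -/
theorem G1QY_gradY_RY (hRR : RY i parS Gp U ∘ₗ divY i U ∘ₗ gradY i U ∘ₗ Gp U ∘ₗ RY i parS Gp U = RY i parS Gp U)
    (hM1 : IsUnit (deltaOneQY i 𝔮 𝔮s parS Gp Δ2 U)) :
    G1QY i 𝔮 𝔮s parS Gp Δ2 U ∘ₗ gradY i U ∘ₗ RY i parS Gp U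
      = gradY i U ∘ₗ Gp U ∘ₗ RY i parS Gp U
        - G1QY i 𝔮 𝔮s parS Gp Δ2 U ∘ₗ (𝔮s U ∘ₗ aY i ∘ₗ 𝔮 U) ∘ₗ gradY i U ∘ₗ Gp U ∘ₗ RY i parS Gp U := by
  have hinv : G1QY i 𝔮 𝔮s parS Gp Δ2 U ∘ₗ deltaOneQY i 𝔮 𝔮s parS Gp Δ2 U = LinearMap.id := Ring.inverse_mul_cancel _ hM1
  have h : G1QY i 𝔮 𝔮s parS Gp Δ2 U ∘ₗ (deltaOneQY i 𝔮 𝔮s parS Gp Δ2 U ∘ₗ gradY i U ∘ₗ Gp U ∘ₗ RY i parS Gp U)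
      = G1QY i 𝔮 𝔮s parS Gp Δ2 U ∘ₗ (gradY i U ∘ₗ RY i parS Gp U + (𝔮s U ∘ₗ aY i ∘ₗ 𝔮 U) ∘ₗ gradY i U ∘ₗ Gp U ∘ₗ RY i parS Gp U) := by
    rw [deltaOneQY_gradY_Gp_RY_of_hRR i 𝔮 𝔮s Δ2 hRR]
  rw [← LinearMap.comp_assoc, hinv, LinearMap.id_comp, LinearMap.comp_add] at h
  exact eq_sub_of_add_eq h.symm

/-- ★★ **(3.152), first half: `R D* G₁ = R Γ D*`** — from the transposed constraint `hZt : R Γ D* 𝔮⋆ = 0`.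
[cite: Balaban1985BackgroundPropagators, (3.152) p.426] -/
theorem RY_divY_G1QY_of_hZt (hRL : RY i parS Gp U ∘ₗ Gp U ∘ₗ divY i U ∘ₗ gradY i U ∘ₗ RY i parS Gp U = RY i parS Gp U)
    (hM1 : IsUnit (deltaOneQY i 𝔮 𝔮s parS Gp Δ2 U)) (hZt : RY i parS Gp U ∘ₗ Gp U ∘ₗ divY i U ∘ₗ 𝔮s U = 0) :
    RY i parS Gp U ∘ₗ divY i U ∘ₗ G1QY i 𝔮 𝔮s parS Gp Δ2 U = RY i parS Gp U ∘ₗ Gp U ∘ₗ divY i U := by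
  have hZt' : (RY i parS Gp U ∘ₗ Gp U ∘ₗ divY i U) ∘ₗ 𝔮s U = 0 := by
    rw [LinearMap.comp_assoc, LinearMap.comp_assoc]
    exact hZt
  have hz : (RY i parS Gp U ∘ₗ Gp U ∘ₗ divY i U) ∘ₗ (𝔮s U ∘ₗ aY i ∘ₗ 𝔮 U) = 0 := by
    rw [← LinearMap.comp_assoc, hZt', LinearMap.zero_comp]
  have h := RY_divY_G1QY i 𝔮 𝔮s Δ2 hRL hM1
  rw [hz, LinearMap.zero_comp, sub_zero, LinearMap.comp_assoc] at h
  exact h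

/-- ★★ **(3.124), middle: `R D* G₁ 𝔮⋆ = 0`** — from `hZt`. [cite: Balaban1985BackgroundPropagators, (3.124) p.420, (3.152) p.426] -/
theorem RY_divY_G1QY_qs_of_hZt (hRL : RY i parS Gp U ∘ₗ Gp U ∘ₗ divY i U ∘ₗ gradY i U ∘ₗ RY i parS Gp U = RY i parS Gp U)
    (hM1 : IsUnit (deltaOneQY i 𝔮 𝔮s parS Gp Δ2 U)) (hZt : RY i parS Gp U ∘ₗ Gp U ∘ₗ divY i U ∘ₗ 𝔮s U = 0) :
    RY i parS Gp U ∘ₗ divY i U ∘ₗ G1QY i 𝔮 𝔮s parS Gp Δ2 U ∘ₗ 𝔮s U = 0 := by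
  have h1 := RY_divY_G1QY_of_hZt i 𝔮 𝔮s Δ2 hRL hM1 hZt
  have hZt' : (RY i parS Gp U ∘ₗ Gp U ∘ₗ divY i U) ∘ₗ 𝔮s U = 0 := by
    rw [LinearMap.comp_assoc, LinearMap.comp_assoc]
    exact hZt
  have h2 : (RY i parS Gp U ∘ₗ divY i U ∘ₗ G1QY i 𝔮 𝔮s parS Gp Δ2 U) ∘ₗ 𝔮s U = (RY i parS Gp U ∘ₗ Gp U ∘ₗ divY i U) ∘ₗ 𝔮s U := by
    rw [h1]
  rw [hZt', LinearMap.comp_assoc, LinearMap.comp_assoc] at h2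
  exact h2

/-- ★★ **(3.124), right: `R D* G₁ D R = R`** — from `hZt` (and `hRL : R Γ D* D R = R`). [cite: Balaban1985BackgroundPropagators, (3.124) p.420] -/
theorem RY_divY_G1QY_gradY_RY_of_hZt (hRL : RY i parS Gp U ∘ₗ Gp U ∘ₗ divY i U ∘ₗ gradY i U ∘ₗ RY i parS Gp U = RY i parS Gp U)
    (hM1 : IsUnit (deltaOneQY i 𝔮 𝔮s parS Gp Δ2 U)) (hZt : RY i parS Gp U ∘ₗ Gp U ∘ₗ divY i U ∘ₗ 𝔮s U = 0) :
    RY i parS Gp U ∘ₗ divY i U ∘ₗ G1QY i 𝔮 𝔮s parS Gp Δ2 U ∘ₗ gradY i U ∘ₗ RY i parS Gp U = RY i parS Gp U := by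
  have h1 := RY_divY_G1QY_of_hZt i 𝔮 𝔮s Δ2 hRL hM1 hZt
  have h2 : (RY i parS Gp U ∘ₗ divY i U ∘ₗ G1QY i 𝔮 𝔮s parS Gp Δ2 U) ∘ₗ (gradY i U ∘ₗ RY i parS Gp U)
      = (RY i parS Gp U ∘ₗ Gp U ∘ₗ divY i U) ∘ₗ (gradY i U ∘ₗ RY i parS Gp U) := by
    rw [h1]
  rw [LinearMap.comp_assoc, LinearMap.comp_assoc, LinearMap.comp_assoc, LinearMap.comp_assoc, hRL] at h2
  exact h2

/-- ★★ **(3.152), second half: `G₁ D R = D Γ R`** — from `hZ : 𝔮 D Γ R = 0` (print: «QDG′R = D₁Q′G′R = 0», (3.115) with `Q′G′R = 0`).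
[cite: Balaban1985BackgroundPropagators, (3.152) p.426, (3.115) p.418] -/
theorem G1QY_gradY_RY_of_hZ (hRR : RY i parS Gp U ∘ₗ divY i U ∘ₗ gradY i U ∘ₗ Gp U ∘ₗ RY i parS Gp U = RY i parS Gp U)
    (hM1 : IsUnit (deltaOneQY i 𝔮 𝔮s parS Gp Δ2 U)) (hZ : 𝔮 U ∘ₗ gradY i U ∘ₗ Gp U ∘ₗ RY i parS Gp U = 0) :
    G1QY i 𝔮 𝔮s parS Gp Δ2 U ∘ₗ gradY i U ∘ₗ RY i parS Gp U = gradY i U ∘ₗ Gp U ∘ₗ RY i parS Gp U := by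
  have hinv : G1QY i 𝔮 𝔮s parS Gp Δ2 U ∘ₗ deltaOneQY i 𝔮 𝔮s parS Gp Δ2 U = LinearMap.id := Ring.inverse_mul_cancel _ hM1
  have hz : (𝔮s U ∘ₗ aY i ∘ₗ 𝔮 U) ∘ₗ gradY i U ∘ₗ Gp U ∘ₗ RY i parS Gp U = 0 := by
    rw [LinearMap.comp_assoc, LinearMap.comp_assoc, hZ, LinearMap.comp_zero, LinearMap.comp_zero]
  have h := deltaOneQY_gradY_Gp_RY_of_hRR i 𝔮 𝔮s Δ2 hRR
  rw [hz, add_zero] at h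
  have h2 : G1QY i 𝔮 𝔮s parS Gp Δ2 U ∘ₗ (deltaOneQY i 𝔮 𝔮s parS Gp Δ2 U ∘ₗ gradY i U ∘ₗ Gp U ∘ₗ RY i parS Gp U)
      = G1QY i 𝔮 𝔮s parS Gp Δ2 U ∘ₗ (gradY i U ∘ₗ RY i parS Gp U) := by
    rw [h]
  rw [← LinearMap.comp_assoc, hinv, LinearMap.id_comp] at h2
  exact h2.symm

/-- ★★ **(3.124), left: `𝔮 G₁ D R = 0`** — from `hZ`. [cite: Balaban1985BackgroundPropagators, (3.124) p.420, (3.152) p.426] -/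
theorem q_G1QY_gradY_RY_of_hZ (hRR : RY i parS Gp U ∘ₗ divY i U ∘ₗ gradY i U ∘ₗ Gp U ∘ₗ RY i parS Gp U = RY i parS Gp U)
    (hM1 : IsUnit (deltaOneQY i 𝔮 𝔮s parS Gp Δ2 U)) (hZ : 𝔮 U ∘ₗ gradY i U ∘ₗ Gp U ∘ₗ RY i parS Gp U = 0) :
    𝔮 U ∘ₗ G1QY i 𝔮 𝔮s parS Gp Δ2 U ∘ₗ gradY i U ∘ₗ RY i parS Gp U = 0 := by
  rw [G1QY_gradY_RY_of_hZ i 𝔮 𝔮s Δ2 hRR hM1 hZ]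
  exact hZ

/-- ★★ **(3.124), right: `R D* G₁ D R = R`** — from `hZ` this time (and `hRR : R D* D Γ R = R`). [cite: Balaban1985BackgroundPropagators, (3.124) p.420] -/
theorem RY_divY_G1QY_gradY_RY_of_hZ (hRR : RY i parS Gp U ∘ₗ divY i U ∘ₗ gradY i U ∘ₗ Gp U ∘ₗ RY i parS Gp U = RY i parS Gp U)
    (hM1 : IsUnit (deltaOneQY i 𝔮 𝔮s parS Gp Δ2 U)) (hZ : 𝔮 U ∘ₗ gradY i U ∘ₗ Gp U ∘ₗ RY i parS Gp U = 0) :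
    RY i parS Gp U ∘ₗ divY i U ∘ₗ G1QY i 𝔮 𝔮s parS Gp Δ2 U ∘ₗ gradY i U ∘ₗ RY i parS Gp U = RY i parS Gp U := by
  rw [G1QY_gradY_RY_of_hZ i 𝔮 𝔮s Δ2 hRR hM1 hZ]
  exact hRR

/-- ★★★ **THE REDUCTION, GENERIC**: over any coefficient algebra, any averaging pair `(𝔮, 𝔮⋆)`, any site transport `parS` and site letter `Γ`
with `R := RY parS Γ` satisfying the displayed (3.24)–(3.25) identities `hRL`, `hRR`, wherever `G₁⁻¹(U)` (3.128) is invertible, the pair of constraints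
`hZ : 𝔮 D Γ R = 0`, `hZt : R Γ D* 𝔮⋆ = 0` yields (3.152) `R D* G₁ = R Γ D*`, `G₁ D R = D Γ R` and (3.124) `𝔮 G₁ D R = 0`, `R D* G₁ 𝔮⋆ = 0`, `R D* G₁ D R = R`.
[cite: Balaban1985BackgroundPropagators, (3.152) p.426, (3.124) p.420, (3.115) p.418, (3.24)–(3.25) p.394] -/
theorem ids3152Q_of_hZ_hZt (hRL : RY i parS Gp U ∘ₗ Gp U ∘ₗ divY i U ∘ₗ gradY i U ∘ₗ RY i parS Gp U = RY i parS Gp U)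
    (hRR : RY i parS Gp U ∘ₗ divY i U ∘ₗ gradY i U ∘ₗ Gp U ∘ₗ RY i parS Gp U = RY i parS Gp U)
    (hM1 : IsUnit (deltaOneQY i 𝔮 𝔮s parS Gp Δ2 U)) (hZ : 𝔮 U ∘ₗ gradY i U ∘ₗ Gp U ∘ₗ RY i parS Gp U = 0)
    (hZt : RY i parS Gp U ∘ₗ Gp U ∘ₗ divY i U ∘ₗ 𝔮s U = 0) :
    RY i parS Gp U ∘ₗ divY i U ∘ₗ G1QY i 𝔮 𝔮s parS Gp Δ2 U = RY i parS Gp U ∘ₗ Gp U ∘ₗ divY i U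
    ∧ G1QY i 𝔮 𝔮s parS Gp Δ2 U ∘ₗ gradY i U ∘ₗ RY i parS Gp U = gradY i U ∘ₗ Gp U ∘ₗ RY i parS Gp U
    ∧ 𝔮 U ∘ₗ G1QY i 𝔮 𝔮s parS Gp Δ2 U ∘ₗ gradY i U ∘ₗ RY i parS Gp U = 0
    ∧ RY i parS Gp U ∘ₗ divY i U ∘ₗ G1QY i 𝔮 𝔮s parS Gp Δ2 U ∘ₗ 𝔮s U = 0
    ∧ RY i parS Gp U ∘ₗ divY i U ∘ₗ G1QY i 𝔮 𝔮s parS Gp Δ2 U ∘ₗ gradY i U ∘ₗ RY i parS Gp U = RY i parS Gp U :=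
  ⟨RY_divY_G1QY_of_hZt i 𝔮 𝔮s Δ2 hRL hM1 hZt, G1QY_gradY_RY_of_hZ i 𝔮 𝔮s Δ2 hRR hM1 hZ, q_G1QY_gradY_RY_of_hZ i 𝔮 𝔮s Δ2 hRR hM1 hZ,
    RY_divY_G1QY_qs_of_hZt i 𝔮 𝔮s Δ2 hRL hM1 hZt, RY_divY_G1QY_gradY_RY_of_hZ i 𝔮 𝔮s Δ2 hRR hM1 hZ⟩

end Gaussian

/-! ## §3 `hZ → hZt` by the trace-adjoint calculus (`𝔮⋆ = 𝔮†` (3.13), `D* = D†` (3.8), `Γ`, `R` symmetric), and the ONE-BINDER reduction -/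

section OneBinder

open scoped Matrix.Norms.L2Operator

variable {N : ℕ} (i : KIdx d ℓ hd hL b₀ b₁) {G : Subgroup (Matrix (Fin N) (Fin N) ℂ)ˣ}
variable (𝔮 : QLetterY (Matrix (Fin N) (Fin N) ℂ) i) (𝔮s : QsLetterY (Matrix (Fin N) (Fin N) ℂ) i)
variable {parS : SiteParY (Matrix (Fin N) (Fin N) ℂ) i} {Gp : SiteOpY (Matrix (Fin N) (Fin N) ℂ) i}

/-- ★★ **`hZ → hZt`, GENERIC**: if `𝔮⋆(U)` is the trace adjoint of `𝔮(U)` ((3.13), the N06 law (L3)), `D*_U` that of `D_U` ((3.8)), and `Γ(U)`, `R(U)` are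
symmetric, then `𝔮 D Γ R = 0` implies its transpose `R Γ D* 𝔮⋆ = 0` (the pairing is nondegenerate: `eq_zero_of_isAdjTr_eq_zero`).
[cite: Balaban1985BackgroundPropagators, (3.8) p.392, (3.13) p.393, (3.25) p.394, p.426] -/
theorem RY_Gp_divY_qs_of_hZ {U : CfgY (Matrix (Fin N) (Fin N) ℂ) i} (hQ : IsAdjTr (fun _ => (1 : ℝ)) (fun _ => (1 : ℝ)) (𝔮 U) (𝔮s U))
    (hD : IsAdjTr (fun _ => (1 : ℝ)) (fun _ => (1 : ℝ)) (gradY i U) (divY i U)) (hGp : IsSymmTr (fun _ => (1 : ℝ)) (Gp U))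
    (hR : IsSymmTr (fun _ => (1 : ℝ)) (RY i parS Gp U)) (hZ : 𝔮 U ∘ₗ gradY i U ∘ₗ Gp U ∘ₗ RY i parS Gp U = 0) :
    RY i parS Gp U ∘ₗ Gp U ∘ₗ divY i U ∘ₗ 𝔮s U = 0 := by
  have h1 : IsAdjTr (fun _ => (1 : ℝ)) (fun _ => (1 : ℝ)) (Gp U ∘ₗ RY i parS Gp U) (RY i parS Gp U ∘ₗ Gp U) :=
    isAdjTr_comp (isAdjTr_of_isSymmTr hGp) (isAdjTr_of_isSymmTr hR)
  have h2 : IsAdjTr (fun _ => (1 : ℝ)) (fun _ => (1 : ℝ)) (gradY i U ∘ₗ Gp U ∘ₗ RY i parS Gp U) ((RY i parS Gp U ∘ₗ Gp U) ∘ₗ divY i U) :=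
    isAdjTr_comp hD h1
  have h3 : IsAdjTr (fun _ => (1 : ℝ)) (fun _ => (1 : ℝ)) (𝔮 U ∘ₗ gradY i U ∘ₗ Gp U ∘ₗ RY i parS Gp U)
      (((RY i parS Gp U ∘ₗ Gp U) ∘ₗ divY i U) ∘ₗ 𝔮s U) :=
    isAdjTr_comp hQ h2
  have h4 := eq_zero_of_isAdjTr_eq_zero (fun _ => one_pos) h3 hZ
  rw [LinearMap.comp_assoc, LinearMap.comp_assoc] at h4
  exact h4

/-- ★★★ **THE REDUCTION, ONE BINDER, GENERIC**: under `hRL`, `hRR`, the adjointness of `(𝔮, 𝔮⋆)` and `(D, D*)` and the symmetry of `Γ`, `R`, wherever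
`G₁⁻¹(U)` is invertible the single constraint `hZ : 𝔮 D Γ R = 0` yields (3.152) `R D* G₁ = R Γ D*`, `G₁ D R = D Γ R` and (3.124) `𝔮 G₁ D R = 0`,
`R D* G₁ 𝔮⋆ = 0`, `R D* G₁ D R = R`. [cite: Balaban1985BackgroundPropagators, (3.152) p.426, (3.124) p.420, (3.115) p.418] -/
theorem ids3152Q_of_hZ (Δ2 : BondOpY (Matrix (Fin N) (Fin N) ℂ) i) {U : CfgY (Matrix (Fin N) (Fin N) ℂ) i}
    (hRL : RY i parS Gp U ∘ₗ Gp U ∘ₗ divY i U ∘ₗ gradY i U ∘ₗ RY i parS Gp U = RY i parS Gp U)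
    (hRR : RY i parS Gp U ∘ₗ divY i U ∘ₗ gradY i U ∘ₗ Gp U ∘ₗ RY i parS Gp U = RY i parS Gp U)
    (hQ : IsAdjTr (fun _ => (1 : ℝ)) (fun _ => (1 : ℝ)) (𝔮 U) (𝔮s U)) (hD : IsAdjTr (fun _ => (1 : ℝ)) (fun _ => (1 : ℝ)) (gradY i U) (divY i U))
    (hGp : IsSymmTr (fun _ => (1 : ℝ)) (Gp U)) (hR : IsSymmTr (fun _ => (1 : ℝ)) (RY i parS Gp U))
    (hM1 : IsUnit (deltaOneQY i 𝔮 𝔮s parS Gp Δ2 U)) (hZ : 𝔮 U ∘ₗ gradY i U ∘ₗ Gp U ∘ₗ RY i parS Gp U = 0) :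
    RY i parS Gp U ∘ₗ divY i U ∘ₗ G1QY i 𝔮 𝔮s parS Gp Δ2 U = RY i parS Gp U ∘ₗ Gp U ∘ₗ divY i U
    ∧ G1QY i 𝔮 𝔮s parS Gp Δ2 U ∘ₗ gradY i U ∘ₗ RY i parS Gp U = gradY i U ∘ₗ Gp U ∘ₗ RY i parS Gp U
    ∧ 𝔮 U ∘ₗ G1QY i 𝔮 𝔮s parS Gp Δ2 U ∘ₗ gradY i U ∘ₗ RY i parS Gp U = 0
    ∧ RY i parS Gp U ∘ₗ divY i U ∘ₗ G1QY i 𝔮 𝔮s parS Gp Δ2 U ∘ₗ 𝔮s U = 0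
    ∧ RY i parS Gp U ∘ₗ divY i U ∘ₗ G1QY i 𝔮 𝔮s parS Gp Δ2 U ∘ₗ gradY i U ∘ₗ RY i parS Gp U = RY i parS Gp U :=
  ids3152Q_of_hZ_hZt i 𝔮 𝔮s Δ2 hRL hRR hM1 hZ (RY_Gp_divY_qs_of_hZ i 𝔮 𝔮s hQ hD hGp hR hZ)

/-! ## §4 The two keyings, every hypothesis discharged by name: `parS := parSymY` (def-Y) and `parS := parKnitY` (dag-n06-l), `Γ := G′_phys` -/

/-- ★★★ **AT THE SYMMETRISED TRANSPORT `parSymY`, `Γ := G′_phys`**: at a `G`-valued background (`G ≤ U(N)`), in print's units (`c_f η = 1`), for ANY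
averaging pair with `𝔮⋆(U) = 𝔮(U)†`, wherever `G₁⁻¹(U)` is invertible, `hZ : 𝔮 D G′ R = 0` yields (3.152) and (3.124) — `hRL`, `hRR` are def-Y's
`RY_GpPhysY_divY_gradY_RY`, `RY_divY_gradY_GpPhysY_RY`, `D* = D†` is `isAdjTr_gradY_divY`, `G′`, `R` symmetric by `isSymmTr_GpPhysY_parSymY`,
`RY_GpPhysY_parSymY_isSymmTr`.  (At the straight pair `(QY parB, QsY parB)` this IS `ids3152_ids3124_of_hZ`: `G1QY_QY` is `rfl`.)
[cite: Balaban1985BackgroundPropagators, (3.152) p.426, (3.124) p.420, (3.24)–(3.25) p.394, (3.35) p.396] -/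
theorem ids3152Q_of_hZ_parSymY (hG : G ≤ unitaryUnits (Matrix (Fin N) (Fin N) ℂ)) (hcf : i.cf * etaS i = 1)
    (Δ2 : BondOpY (Matrix (Fin N) (Fin N) ℂ) i) {U : CfgY (Matrix (Fin N) (Fin N) ℂ) i} (hU : ∀ μ x, U μ x ∈ G)
    (hQ : IsAdjTr (fun _ => (1 : ℝ)) (fun _ => (1 : ℝ)) (𝔮 U) (𝔮s U))
    (hM1 : IsUnit (deltaOneQY i 𝔮 𝔮s (parSymY i) (GpPhysY i (parSymY i)) Δ2 U))
    (hZ : 𝔮 U ∘ₗ gradY i U ∘ₗ GpPhysY i (parSymY i) U ∘ₗ RY i (parSymY i) (GpPhysY i (parSymY i)) U = 0) :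
    RY i (parSymY i) (GpPhysY i (parSymY i)) U ∘ₗ divY i U ∘ₗ G1QY i 𝔮 𝔮s (parSymY i) (GpPhysY i (parSymY i)) Δ2 U
        = RY i (parSymY i) (GpPhysY i (parSymY i)) U ∘ₗ GpPhysY i (parSymY i) U ∘ₗ divY i U
    ∧ G1QY i 𝔮 𝔮s (parSymY i) (GpPhysY i (parSymY i)) Δ2 U ∘ₗ gradY i U ∘ₗ RY i (parSymY i) (GpPhysY i (parSymY i)) U
        = gradY i U ∘ₗ GpPhysY i (parSymY i) U ∘ₗ RY i (parSymY i) (GpPhysY i (parSymY i)) U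
    ∧ 𝔮 U ∘ₗ G1QY i 𝔮 𝔮s (parSymY i) (GpPhysY i (parSymY i)) Δ2 U ∘ₗ gradY i U ∘ₗ RY i (parSymY i) (GpPhysY i (parSymY i)) U = 0
    ∧ RY i (parSymY i) (GpPhysY i (parSymY i)) U ∘ₗ divY i U ∘ₗ G1QY i 𝔮 𝔮s (parSymY i) (GpPhysY i (parSymY i)) Δ2 U ∘ₗ 𝔮s U = 0
    ∧ RY i (parSymY i) (GpPhysY i (parSymY i)) U ∘ₗ divY i U ∘ₗ G1QY i 𝔮 𝔮s (parSymY i) (GpPhysY i (parSymY i)) Δ2 U ∘ₗ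
        gradY i U ∘ₗ RY i (parSymY i) (GpPhysY i (parSymY i)) U = RY i (parSymY i) (GpPhysY i (parSymY i)) U := by
  have hU' : ∀ μ x, ((U μ x : (Matrix (Fin N) (Fin N) ℂ)ˣ) : Matrix (Fin N) (Fin N) ℂ) ∈ unitary (Matrix (Fin N) (Fin N) ℂ) :=
    fun μ x => hG (hU μ x)
  exact ids3152Q_of_hZ i 𝔮 𝔮s Δ2 (RY_GpPhysY_divY_gradY_RY i hG hcf hU) (RY_divY_gradY_GpPhysY_RY i hG hcf hU) hQ
    (isAdjTr_gradY_divY i U hU') (isSymmTr_GpPhysY_parSymY i hG hU) (RY_GpPhysY_parSymY_isSymmTr i hG hU) hM1 hZ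

/-- ★★★ **AT PRINT'S KNIT TRANSPORT `parKnitY`, `Γ := G′_phys`** (def-Y's option (b), dag-n06-l's keying of rows 20–21): at a `G`-valued background with
`G`-valued knit legs (`G ≤ U(N)`), in print's units, for ANY averaging pair with `𝔮⋆(U) = 𝔮(U)†`, wherever `G₁⁻¹(U)` is invertible, `hZ : 𝔮 D G′ R = 0`
yields (3.152) and (3.124) — `hRL`, `hRR` are dag-n06-l's `RY_GpPhysY_divY_gradY_RY_parKnitY`, `RY_divY_gradY_GpPhysY_RY_parKnitY`; `G′ = η²(Δ′_a)⁻¹`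
symmetric by `symm0_parKnitY`, `R` by `RY_parKnitY_isSymmTr`.
[cite: Balaban1985BackgroundPropagators, (3.152) p.426, (3.124) p.420, (3.24)–(3.25) p.394] [cite: Balaban1985Averaging, Prop. 2 p.26] -/
theorem ids3152Q_of_hZ_parKnitY (hG : G ≤ unitaryUnits (Matrix (Fin N) (Fin N) ℂ)) (hcf : i.cf * etaS i = 1)
    (Δ2 : BondOpY (Matrix (Fin N) (Fin N) ℂ) i) {U : CfgY (Matrix (Fin N) (Fin N) ℂ) i} (hU : ∀ μ x, U μ x ∈ G)
    (hpar : ∀ z w : SiteY i, parKnitY i U z w ∈ G) (hQ : IsAdjTr (fun _ => (1 : ℝ)) (fun _ => (1 : ℝ)) (𝔮 U) (𝔮s U))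
    (hM1 : IsUnit (deltaOneQY i 𝔮 𝔮s (parKnitY i) (GpPhysY i (parKnitY i)) Δ2 U))
    (hZ : 𝔮 U ∘ₗ gradY i U ∘ₗ GpPhysY i (parKnitY i) U ∘ₗ RY i (parKnitY i) (GpPhysY i (parKnitY i)) U = 0) :
    RY i (parKnitY i) (GpPhysY i (parKnitY i)) U ∘ₗ divY i U ∘ₗ G1QY i 𝔮 𝔮s (parKnitY i) (GpPhysY i (parKnitY i)) Δ2 U
        = RY i (parKnitY i) (GpPhysY i (parKnitY i)) U ∘ₗ GpPhysY i (parKnitY i) U ∘ₗ divY i U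
    ∧ G1QY i 𝔮 𝔮s (parKnitY i) (GpPhysY i (parKnitY i)) Δ2 U ∘ₗ gradY i U ∘ₗ RY i (parKnitY i) (GpPhysY i (parKnitY i)) U
        = gradY i U ∘ₗ GpPhysY i (parKnitY i) U ∘ₗ RY i (parKnitY i) (GpPhysY i (parKnitY i)) U
    ∧ 𝔮 U ∘ₗ G1QY i 𝔮 𝔮s (parKnitY i) (GpPhysY i (parKnitY i)) Δ2 U ∘ₗ gradY i U ∘ₗ RY i (parKnitY i) (GpPhysY i (parKnitY i)) U = 0
    ∧ RY i (parKnitY i) (GpPhysY i (parKnitY i)) U ∘ₗ divY i U ∘ₗ G1QY i 𝔮 𝔮s (parKnitY i) (GpPhysY i (parKnitY i)) Δ2 U ∘ₗ 𝔮s U = 0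
    ∧ RY i (parKnitY i) (GpPhysY i (parKnitY i)) U ∘ₗ divY i U ∘ₗ G1QY i 𝔮 𝔮s (parKnitY i) (GpPhysY i (parKnitY i)) Δ2 U ∘ₗ
        gradY i U ∘ₗ RY i (parKnitY i) (GpPhysY i (parKnitY i)) U = RY i (parKnitY i) (GpPhysY i (parKnitY i)) U := by
  have hU' : ∀ μ x, ((U μ x : (Matrix (Fin N) (Fin N) ℂ)ˣ) : Matrix (Fin N) (Fin N) ℂ) ∈ unitary (Matrix (Fin N) (Fin N) ℂ) :=
    fun μ x => hG (hU μ x)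
  have hGp : IsSymmTr (fun _ => (1 : ℝ)) (GpPhysY i (parKnitY i) U) := by
    rw [GpPhysY_apply]
    exact isSymmTr_coe_real_smul _ _ (GpY_isSymmTr i (parKnitY i) U (symm0_parKnitY i hG hU hpar))
  have hR : IsSymmTr (fun _ => (1 : ℝ)) (RY i (parKnitY i) (GpPhysY i (parKnitY i)) U) := by
    rw [RY_GpPhysY]
    exact RY_parKnitY_isSymmTr i hG hU hpar
  exact ids3152Q_of_hZ i 𝔮 𝔮s Δ2 (RY_GpPhysY_divY_gradY_RY_parKnitY i hG hcf hU hpar) (RY_divY_gradY_GpPhysY_RY_parKnitY i hG hcf hU hpar) hQ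
    (isAdjTr_gradY_divY i U hU') hGp hR hM1 hZ

/-- ★★★ **AT `parKnitY` ON PRINT'S CLASS (3.35)**: for every background of the member's class `(bg9KP …).Reg335 c₀ α₀` with `G ≤ U(N)` unit-bounded,
`c₀ ≤ 10`, `0 ≤ Mα₀` and the x-free numerics `K_pl(Mα₀)·L⁴ < α₀′`, `C₀α₀′ ≤ 1/3`, `2α₀′ ≤ c₂′` (knit legs unitary by
`parKnitY_mem_unitary_of_reg335P`; §4 at `G := U(N)`), for ANY pair with `𝔮⋆(U) = 𝔮(U)†`, wherever `G₁⁻¹(U)` is invertible, `hZ` yields (3.152) and (3.124).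
[cite: Balaban1985BackgroundPropagators, (3.152) p.426, (3.124) p.420, (3.35) p.396] [cite: Balaban1985Averaging, Prop. 2 p.26] -/
theorem ids3152Q_of_hZ_parKnitY_of_reg335P [Nonempty (Fin N)]
    (hG1 : ∀ u : (Matrix (Fin N) (Fin N) ℂ)ˣ, u ∈ G → ‖(u : Matrix (Fin N) (Fin N) ℂ)‖ ≤ 1) (hGU : G ≤ unitaryUnits (Matrix (Fin N) (Fin N) ℂ))
    {U : CfgY (Matrix (Fin N) (Fin N) ℂ) i} {c₀ α₀ : ℝ} (hc : c₀ ≤ 10) (hMα : 0 ≤ (kGeo i).M * α₀)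
    (hreg : (bg9KP (Matrix (Fin N) (Fin N) ℂ) G i).Reg335 c₀ α₀ U) {α₀' : ℝ} (hα' : 0 < α₀') (hα3 : C0 (d + 1) * α₀' ≤ 1 / 3)
    (hα2 : 2 * α₀' ≤ c2' (d + 1) (ℓ + 1)) (hK : Kpl i ((kGeo i).M * α₀) * (kGeo i).L ^ 4 < α₀') (hcf : i.cf * etaS i = 1)
    (Δ2 : BondOpY (Matrix (Fin N) (Fin N) ℂ) i) (hQ : IsAdjTr (fun _ => (1 : ℝ)) (fun _ => (1 : ℝ)) (𝔮 U) (𝔮s U))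
    (hM1 : IsUnit (deltaOneQY i 𝔮 𝔮s (parKnitY i) (GpPhysY i (parKnitY i)) Δ2 U))
    (hZ : 𝔮 U ∘ₗ gradY i U ∘ₗ GpPhysY i (parKnitY i) U ∘ₗ RY i (parKnitY i) (GpPhysY i (parKnitY i)) U = 0) :
    RY i (parKnitY i) (GpPhysY i (parKnitY i)) U ∘ₗ divY i U ∘ₗ G1QY i 𝔮 𝔮s (parKnitY i) (GpPhysY i (parKnitY i)) Δ2 U
        = RY i (parKnitY i) (GpPhysY i (parKnitY i)) U ∘ₗ GpPhysY i (parKnitY i) U ∘ₗ divY i U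
    ∧ G1QY i 𝔮 𝔮s (parKnitY i) (GpPhysY i (parKnitY i)) Δ2 U ∘ₗ gradY i U ∘ₗ RY i (parKnitY i) (GpPhysY i (parKnitY i)) U
        = gradY i U ∘ₗ GpPhysY i (parKnitY i) U ∘ₗ RY i (parKnitY i) (GpPhysY i (parKnitY i)) U
    ∧ 𝔮 U ∘ₗ G1QY i 𝔮 𝔮s (parKnitY i) (GpPhysY i (parKnitY i)) Δ2 U ∘ₗ gradY i U ∘ₗ RY i (parKnitY i) (GpPhysY i (parKnitY i)) U = 0
    ∧ RY i (parKnitY i) (GpPhysY i (parKnitY i)) U ∘ₗ divY i U ∘ₗ G1QY i 𝔮 𝔮s (parKnitY i) (GpPhysY i (parKnitY i)) Δ2 U ∘ₗ 𝔮s U = 0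
    ∧ RY i (parKnitY i) (GpPhysY i (parKnitY i)) U ∘ₗ divY i U ∘ₗ G1QY i 𝔮 𝔮s (parKnitY i) (GpPhysY i (parKnitY i)) Δ2 U ∘ₗ
        gradY i U ∘ₗ RY i (parKnitY i) (GpPhysY i (parKnitY i)) U = RY i (parKnitY i) (GpPhysY i (parKnitY i)) U :=
  ids3152Q_of_hZ_parKnitY i 𝔮 𝔮s (G := unitaryUnits _) le_rfl hcf Δ2 (fun μ x => hGU (mem_of_reg335P (G := G) i hreg μ x))
    (parKnitY_mem_unitary_of_reg335P i hG1 hGU U hc hMα hreg hα' hα3 hα2 hK) hQ hM1 hZ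

/-! ## §5 At print's knit pair on (3.35): NO constraint binder; the record-level reading; the certificate's law-level reading -/

/-- ★★★ **(3.152) AND (3.124) AT PRINT'S KNIT PAIR `(QknitY, QknitY†)` ON (3.35), FROM (3.138) ALONE**: for every background of the member's class
`(bg9KP …).Reg335 c₀ α₀` (`G ≤ U(N)` unit-bounded, `c₀ ≤ 10`, `0 ≤ Mα₀`, `K_pl(Mα₀)·L⁴ < α₀′`, `C₀α₀′ ≤ 1/3`, `2α₀′ ≤ c₂′`), in print's units, wherever
`G₁⁻¹(U)` is invertible: `R D* G₁ = R G′ D*`, `G₁ D R = D G′ R`, `Q G₁ D R = 0`, `R D* G₁ Q* = 0`, `R D* G₁ D R = R` — print's «QDG′R = D₁Q′G′R = 0» IS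
dag-n06-l's theorem `QknitY_gradY_GpPhysY_RY_parKnitY_of_reg335P`, and `Q* = Q†` (`isAdjTr_adjTrY`).
[cite: Balaban1985BackgroundPropagators, (3.152) p.426, (3.124) p.420, (3.115) p.418, (3.138) p.423, (3.35) p.396] [cite: Balaban1985Averaging, Prop. 2 p.26] -/
theorem ids3152Q_knitPair_of_reg335P [Nonempty (Fin N)]
    (hG1 : ∀ u : (Matrix (Fin N) (Fin N) ℂ)ˣ, u ∈ G → ‖(u : Matrix (Fin N) (Fin N) ℂ)‖ ≤ 1) (hGU : G ≤ unitaryUnits (Matrix (Fin N) (Fin N) ℂ))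
    {U : CfgY (Matrix (Fin N) (Fin N) ℂ) i} {c₀ α₀ : ℝ} (hc : c₀ ≤ 10) (hMα : 0 ≤ (kGeo i).M * α₀)
    (hreg : (bg9KP (Matrix (Fin N) (Fin N) ℂ) G i).Reg335 c₀ α₀ U) {α₀' : ℝ} (hα' : 0 < α₀') (hα3 : C0 (d + 1) * α₀' ≤ 1 / 3)
    (hα2 : 2 * α₀' ≤ c2' (d + 1) (ℓ + 1)) (hK : Kpl i ((kGeo i).M * α₀) * (kGeo i).L ^ 4 < α₀') (hcf : i.cf * etaS i = 1)
    (Δ2 : BondOpY (Matrix (Fin N) (Fin N) ℂ) i)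
    (hM1 : IsUnit (deltaOneQY i (QknitY i) (fun V => adjTrY (QknitY i V)) (parKnitY i) (GpPhysY i (parKnitY i)) Δ2 U)) :
    RY i (parKnitY i) (GpPhysY i (parKnitY i)) U ∘ₗ divY i U ∘ₗ G1QY i (QknitY i) (fun V => adjTrY (QknitY i V)) (parKnitY i) (GpPhysY i (parKnitY i)) Δ2 U
        = RY i (parKnitY i) (GpPhysY i (parKnitY i)) U ∘ₗ GpPhysY i (parKnitY i) U ∘ₗ divY i U
    ∧ G1QY i (QknitY i) (fun V => adjTrY (QknitY i V)) (parKnitY i) (GpPhysY i (parKnitY i)) Δ2 U ∘ₗ gradY i U ∘ₗ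
          RY i (parKnitY i) (GpPhysY i (parKnitY i)) U
        = gradY i U ∘ₗ GpPhysY i (parKnitY i) U ∘ₗ RY i (parKnitY i) (GpPhysY i (parKnitY i)) U
    ∧ QknitY i U ∘ₗ G1QY i (QknitY i) (fun V => adjTrY (QknitY i V)) (parKnitY i) (GpPhysY i (parKnitY i)) Δ2 U ∘ₗ gradY i U ∘ₗ
          RY i (parKnitY i) (GpPhysY i (parKnitY i)) U = 0
    ∧ RY i (parKnitY i) (GpPhysY i (parKnitY i)) U ∘ₗ divY i U ∘ₗ
          G1QY i (QknitY i) (fun V => adjTrY (QknitY i V)) (parKnitY i) (GpPhysY i (parKnitY i)) Δ2 U ∘ₗ adjTrY (QknitY i U) = 0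
    ∧ RY i (parKnitY i) (GpPhysY i (parKnitY i)) U ∘ₗ divY i U ∘ₗ
          G1QY i (QknitY i) (fun V => adjTrY (QknitY i V)) (parKnitY i) (GpPhysY i (parKnitY i)) Δ2 U ∘ₗ
          gradY i U ∘ₗ RY i (parKnitY i) (GpPhysY i (parKnitY i)) U = RY i (parKnitY i) (GpPhysY i (parKnitY i)) U :=
  ids3152Q_of_hZ_parKnitY_of_reg335P i (QknitY i) (fun V => adjTrY (QknitY i V)) hG1 hGU hc hMα hreg hα' hα3 hα2 hK hcf Δ2
    (isAdjTr_adjTrY (QknitY i U)) hM1 (QknitY_gradY_GpPhysY_RY_parKnitY_of_reg335P i hG1 hGU hc hMα hreg hα' hα3 hα2 hK)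

variable {𝔮 𝔮s}

/-- ★★ **THE CERTIFICATE'S ROW SHAPE, KNIT-KEYED**: the N06 laws (L8) `IsNullOnQ (regQY G i c₀ α₀) 𝔮 parKnitY` and (L3) `IsAdjOnQ (regQY G i c₀ α₀) 𝔮 𝔮⋆`
of a generic pair as binders give, at every `U` of the regime of record and wherever `G₁⁻¹(U)` is invertible, (3.152) and (3.124) (rows 20–21 of the
N06 table + the (3.152) row).  For def-Y's knit family of record the two laws are `isNullOnQ_qKnitOfRecord`, `isAdjOnQ_qKnitOfRecord` (`Node00.OpsYQLetter`).
[cite: Balaban1985BackgroundPropagators, (3.152) p.426, (3.124) p.420, (3.115) p.418, (3.13) p.393, (3.35) p.396] -/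
theorem ids3152Q_of_isNullOnQ_parKnitY_regQY [Nonempty (Fin N)]
    (hG1 : ∀ u : (Matrix (Fin N) (Fin N) ℂ)ˣ, u ∈ G → ‖(u : Matrix (Fin N) (Fin N) ℂ)‖ ≤ 1) (hGU : G ≤ unitaryUnits (Matrix (Fin N) (Fin N) ℂ))
    {c₀ α₀ : ℝ} (hc : c₀ ≤ 10) (hMα : 0 ≤ (kGeo i).M * α₀) {α₀' : ℝ} (hα' : 0 < α₀') (hα3 : C0 (d + 1) * α₀' ≤ 1 / 3)
    (hα2 : 2 * α₀' ≤ c2' (d + 1) (ℓ + 1)) (hK : Kpl i ((kGeo i).M * α₀) * (kGeo i).L ^ 4 < α₀') (hcf : i.cf * etaS i = 1)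
    (hnull : IsNullOnQ (regQY G i c₀ α₀) 𝔮 (parKnitY i)) (hadj : IsAdjOnQ (regQY G i c₀ α₀) 𝔮 𝔮s)
    (Δ2 : BondOpY (Matrix (Fin N) (Fin N) ℂ) i) {U : CfgY (Matrix (Fin N) (Fin N) ℂ) i} (hU : regQY G i c₀ α₀ U)
    (hM1 : IsUnit (deltaOneQY i 𝔮 𝔮s (parKnitY i) (GpPhysY i (parKnitY i)) Δ2 U)) :
    RY i (parKnitY i) (GpPhysY i (parKnitY i)) U ∘ₗ divY i U ∘ₗ G1QY i 𝔮 𝔮s (parKnitY i) (GpPhysY i (parKnitY i)) Δ2 U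
        = RY i (parKnitY i) (GpPhysY i (parKnitY i)) U ∘ₗ GpPhysY i (parKnitY i) U ∘ₗ divY i U
    ∧ G1QY i 𝔮 𝔮s (parKnitY i) (GpPhysY i (parKnitY i)) Δ2 U ∘ₗ gradY i U ∘ₗ RY i (parKnitY i) (GpPhysY i (parKnitY i)) U
        = gradY i U ∘ₗ GpPhysY i (parKnitY i) U ∘ₗ RY i (parKnitY i) (GpPhysY i (parKnitY i)) U
    ∧ 𝔮 U ∘ₗ G1QY i 𝔮 𝔮s (parKnitY i) (GpPhysY i (parKnitY i)) Δ2 U ∘ₗ gradY i U ∘ₗ RY i (parKnitY i) (GpPhysY i (parKnitY i)) U = 0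
    ∧ RY i (parKnitY i) (GpPhysY i (parKnitY i)) U ∘ₗ divY i U ∘ₗ G1QY i 𝔮 𝔮s (parKnitY i) (GpPhysY i (parKnitY i)) Δ2 U ∘ₗ 𝔮s U = 0
    ∧ RY i (parKnitY i) (GpPhysY i (parKnitY i)) U ∘ₗ divY i U ∘ₗ G1QY i 𝔮 𝔮s (parKnitY i) (GpPhysY i (parKnitY i)) Δ2 U ∘ₗ
        gradY i U ∘ₗ RY i (parKnitY i) (GpPhysY i (parKnitY i)) U = RY i (parKnitY i) (GpPhysY i (parKnitY i)) U :=
  ids3152Q_of_hZ_parKnitY_of_reg335P i 𝔮 𝔮s hG1 hGU hc hMα hU hα' hα3 hα2 hK hcf Δ2 (hadj U hU) hM1 (hnull U hU)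

/-- ★★ **THE CERTIFICATE'S ROW SHAPE, `parSymY`-KEYED**: the laws (L8) `IsNullOnQ (regQY G i c₀ α₀) 𝔮 parSymY` and (L3) `IsAdjOnQ (regQY G i c₀ α₀) 𝔮 𝔮⋆`
as binders give, at every `U` of the regime of record (`G ≤ U(N)`) and wherever `G₁⁻¹(U)` is invertible, (3.152) and (3.124).
[cite: Balaban1985BackgroundPropagators, (3.152) p.426, (3.124) p.420, (3.115) p.418, (3.13) p.393, (3.35) p.396] -/
theorem ids3152Q_of_isNullOnQ_parSymY_regQY (hGU : G ≤ unitaryUnits (Matrix (Fin N) (Fin N) ℂ)) (hcf : i.cf * etaS i = 1) {c₀ α₀ : ℝ}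
    (hnull : IsNullOnQ (regQY G i c₀ α₀) 𝔮 (parSymY i)) (hadj : IsAdjOnQ (regQY G i c₀ α₀) 𝔮 𝔮s)
    (Δ2 : BondOpY (Matrix (Fin N) (Fin N) ℂ) i) {U : CfgY (Matrix (Fin N) (Fin N) ℂ) i} (hU : regQY G i c₀ α₀ U)
    (hM1 : IsUnit (deltaOneQY i 𝔮 𝔮s (parSymY i) (GpPhysY i (parSymY i)) Δ2 U)) :
    RY i (parSymY i) (GpPhysY i (parSymY i)) U ∘ₗ divY i U ∘ₗ G1QY i 𝔮 𝔮s (parSymY i) (GpPhysY i (parSymY i)) Δ2 U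
        = RY i (parSymY i) (GpPhysY i (parSymY i)) U ∘ₗ GpPhysY i (parSymY i) U ∘ₗ divY i U
    ∧ G1QY i 𝔮 𝔮s (parSymY i) (GpPhysY i (parSymY i)) Δ2 U ∘ₗ gradY i U ∘ₗ RY i (parSymY i) (GpPhysY i (parSymY i)) U
        = gradY i U ∘ₗ GpPhysY i (parSymY i) U ∘ₗ RY i (parSymY i) (GpPhysY i (parSymY i)) U
    ∧ 𝔮 U ∘ₗ G1QY i 𝔮 𝔮s (parSymY i) (GpPhysY i (parSymY i)) Δ2 U ∘ₗ gradY i U ∘ₗ RY i (parSymY i) (GpPhysY i (parSymY i)) U = 0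
    ∧ RY i (parSymY i) (GpPhysY i (parSymY i)) U ∘ₗ divY i U ∘ₗ G1QY i 𝔮 𝔮s (parSymY i) (GpPhysY i (parSymY i)) Δ2 U ∘ₗ 𝔮s U = 0
    ∧ RY i (parSymY i) (GpPhysY i (parSymY i)) U ∘ₗ divY i U ∘ₗ G1QY i 𝔮 𝔮s (parSymY i) (GpPhysY i (parSymY i)) Δ2 U ∘ₗ
        gradY i U ∘ₗ RY i (parSymY i) (GpPhysY i (parSymY i)) U = RY i (parSymY i) (GpPhysY i (parSymY i)) U :=
  ids3152Q_of_hZ_parSymY i 𝔮 𝔮s hGU hcf Δ2 (mem_of_regQY (i := i) hU) (hadj U hU) hM1 (hnull U hU)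

end OneBinder

section Record

open scoped Matrix.Norms.L2Operator

/-- ★★★ **(3.152) AND (3.124) FOR def-Y's KNIT FAMILY OF RECORD `(qKnitOfRecord, qsKnitOfRecord)` ON THE REGIME OF RECORD `regQY`, FROM (3.138) ALONE**:
indexwise over a stage `θ`, at every `U` of the regime of record (with `G ≤ U(N)` unit-bounded, `c₀ ≤ 10`, `0 ≤ Mα₀` and the x-free numerics), in print's units,
wherever `G₁⁻¹(U)` is invertible — the record-level reading of `ids3152Q_knitPair_of_reg335P` (the families of record are `QknitY`, `adjTrY ∘ QknitY` on the nose).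
[cite: Balaban1985BackgroundPropagators, (3.152) p.426, (3.124) p.420, (3.115) p.418, (3.138) p.423, (3.35) p.396] [cite: Balaban1985Averaging, Prop. 2 p.26] -/
theorem ids3152Q_qKnitOfRecord_of_regQY (N : ℕ) [Nonempty (Fin N)] (θ : Stage3Params) {G : Subgroup (Matrix (Fin N) (Fin N) ℂ)ˣ}
    (hG1 : ∀ u : (Matrix (Fin N) (Fin N) ℂ)ˣ, u ∈ G → ‖(u : Matrix (Fin N) (Fin N) ℂ)‖ ≤ 1) (hGU : G ≤ unitaryUnits (Matrix (Fin N) (Fin N) ℂ))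
    {c₀ α₀ : ℝ} (hc : c₀ ≤ 10) (i : KIdx θ.d₆ θ.ℓ₆ θ.hd' θ.hL' θ.b₀ θ.b₁) (hMα : 0 ≤ (kGeo i).M * α₀) {α₀' : ℝ} (hα' : 0 < α₀')
    (hα3 : C0 (θ.d₆ + 1) * α₀' ≤ 1 / 3) (hα2 : 2 * α₀' ≤ c2' (θ.d₆ + 1) (θ.ℓ₆ + 1)) (hK : Kpl i ((kGeo i).M * α₀) * (kGeo i).L ^ 4 < α₀')
    (hcf : i.cf * etaS i = 1) (Δ2 : BondOpY (Matrix (Fin N) (Fin N) ℂ) i) {U : CfgY (Matrix (Fin N) (Fin N) ℂ) i} (hU : regQY G i c₀ α₀ U)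
    (hM1 : IsUnit (deltaOneQY i (qKnitOfRecord N θ i) (qsKnitOfRecord N θ i) (parKnitY i) (GpPhysY i (parKnitY i)) Δ2 U)) :
    RY i (parKnitY i) (GpPhysY i (parKnitY i)) U ∘ₗ divY i U ∘ₗ G1QY i (qKnitOfRecord N θ i) (qsKnitOfRecord N θ i) (parKnitY i) (GpPhysY i (parKnitY i)) Δ2 U
        = RY i (parKnitY i) (GpPhysY i (parKnitY i)) U ∘ₗ GpPhysY i (parKnitY i) U ∘ₗ divY i U
    ∧ G1QY i (qKnitOfRecord N θ i) (qsKnitOfRecord N θ i) (parKnitY i) (GpPhysY i (parKnitY i)) Δ2 U ∘ₗ gradY i U ∘ₗ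
          RY i (parKnitY i) (GpPhysY i (parKnitY i)) U
        = gradY i U ∘ₗ GpPhysY i (parKnitY i) U ∘ₗ RY i (parKnitY i) (GpPhysY i (parKnitY i)) U
    ∧ qKnitOfRecord N θ i U ∘ₗ G1QY i (qKnitOfRecord N θ i) (qsKnitOfRecord N θ i) (parKnitY i) (GpPhysY i (parKnitY i)) Δ2 U ∘ₗ gradY i U ∘ₗ
          RY i (parKnitY i) (GpPhysY i (parKnitY i)) U = 0
    ∧ RY i (parKnitY i) (GpPhysY i (parKnitY i)) U ∘ₗ divY i U ∘ₗ
          G1QY i (qKnitOfRecord N θ i) (qsKnitOfRecord N θ i) (parKnitY i) (GpPhysY i (parKnitY i)) Δ2 U ∘ₗ qsKnitOfRecord N θ i U = 0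
    ∧ RY i (parKnitY i) (GpPhysY i (parKnitY i)) U ∘ₗ divY i U ∘ₗ
          G1QY i (qKnitOfRecord N θ i) (qsKnitOfRecord N θ i) (parKnitY i) (GpPhysY i (parKnitY i)) Δ2 U ∘ₗ
          gradY i U ∘ₗ RY i (parKnitY i) (GpPhysY i (parKnitY i)) U = RY i (parKnitY i) (GpPhysY i (parKnitY i)) U :=
  ids3152Q_knitPair_of_reg335P i hG1 hGU hc hMα hU hα' hα3 hα2 hK hcf Δ2 hM1

end Record

end

end Literature.MathematicalPhysics.QuantumFieldTheory.Balaban1983to89.Node00
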